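import Mathlib.NumberTheory.ArithmeticFunction.Moebius
import Mathlib.NumberTheory.SmoothNumbers
import Mathlib.Analysis.Complex.Basic
import Mathlib.Data.Nat.Factorization.Basic
import Mathlib.Data.Nat.Cast.Order.Field
import Mathlib.Data.Nat.ModEq
import HarnessLib

/-!
# Möbius expansion of a coprimality-restricted double sum

Topic `Literature/NumberTheory/Sieve`; a PROVED tool file (theorems only: no definitions, no named facts).
For a weight `f : ℕ → ℕ → ℂ` and finite sets `A, B ⊆ ℕ` of positive integers, the classical expansion of
a coprimality constraint by the Möbius function, `1_{gcd(m,b)=1} = ∑_{g ∣ gcd(m,b)} μ(g)` (i.e. `μ * ζ = 1`,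
Mathlib's `ArithmeticFunction.coe_moebius_mul_coe_zeta`), gives:

* `sum_sum_ite_coprime_eq_sum_moebius` (**exact expansion**): if `A ⊆ [1, G]` then
  `∑_{m ∈ A} ∑_{b ∈ B} 1_{gcd(m,b)=1} f(m,b) = ∑_{g=1}^{G} μ(g) S_g`,
  `S_g := ∑_{m ∈ A, g ∣ m} ∑_{b ∈ B, g ∣ b} f(m,b)` (the divisors of `gcd(m,b)` are `≤ m ≤ G`); the primed
  variant bounds `g` through `B ⊆ [1, G]` instead;
* `norm_sub_sum_Icc_le` (**truncation**): for `G₀ ≤ G` the expansion truncated at `g ≤ G₀` is off by at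
  most `∑_{G₀ < g ≤ G} ‖S_g‖ ≤ ∑_{G₀ < g ≤ G} ∑_{m ∈ A, g∣m} ∑_{b ∈ B, g∣b} ‖f(m,b)‖` (`|μ| ≤ 1`),
  `= ∑_{G₀ < g ≤ G} Re S_g` for real nonnegative weights (`norm_sub_sum_Icc_le_sum_re`), and
  (`norm_sub_sum_Icc_le_crude`) by the CRUDE TAIL `C N N' / G₀` when `‖f‖ ≤ C` on `A × B`, `A ⊆ [1, N]`,
  `B ⊆ [1, N']`, `1 ≤ G₀` (`#{m ∈ A : g ∣ m} ≤ N/g` and `∑_{g > G₀} 1/g² ≤ 1/G₀`);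
* **re-indexing the sublattice** `m = g m'`: `sum_filter_dvd_eq_sum_image_div` (any finite `A`), and for
  the friable boxes `A = S(N, k) \ S(N', k)`, `S(N, k) = Nat.smoothNumbersUpTo N k` (the `k`-smooth, i.e.
  `(k-1)`-friable, `n ≤ N`), with `g` itself `k`-smooth: `{m ∈ A : g ∣ m} = g · (S(N/g, k) \ S(N'/g, k))`
  (`filter_dvd_smoothNumbersUpTo_sdiff`; sum form `sum_filter_dvd_smoothNumbersUpTo_sdiff`; image form
  `image_div_filter_dvd_smoothNumbersUpTo_sdiff`), while for `g` NOT `k`-smooth the sublattice is EMPTY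
  (`filter_dvd_eq_empty_of_not_mem_smoothNumbers`);
* **class transport** along `m = g m'` for `g` invertible modulo `M₀` (`g u ≡ 1 (mod M₀)`):
  `g m' ≡ c ⟺ m' ≡ c u (mod M₀)` (`mul_modEq_iff`, `modEq_iff_div_modEq`, `exists_mul_modEq_one`).

Everything here is elementary and standard ([folklore]); the expansion of a coprimality condition inside a
double sum with a truncated range of `g` is the usual opening move of sieve arguments, cf.
[MontgomeryVaughan2007, §1.3 (the Möbius function) and §3.1].  Consumer: the coprimality-restricted cell
counts of the crux `TameLocalReceptacle` of the summit `ABC`, where each `S_g` is a ternary friable count at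
scales divided by `g` and the range `g > G₀` is a crude tail.  Deliberately NOT here: any estimate of the
individual `S_g` (friable counting) and the optimisation of `G₀`.

## References

* H. L. Montgomery, R. C. Vaughan, *Multiplicative Number Theory I. Classical Theory*, Cambridge Studies in
  Advanced Mathematics 97, CUP 2007, §1.3 [MontgomeryVaughan2007].
-/

noncomputable section

open Finset
open scoped ArithmeticFunction.Moebius

namespace Literature.NumberTheory.Sieve

namespace CoprimeMoebiusExpansion

/-! ### The indicator of coprimality as a Möbius sum -/

/-- **Möbius inversion of the coprimality indicator**: `1_{gcd(m,b)=1} = ∑_{g ∣ gcd(m,b)} μ(g)`, i.e.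
`∑_{d ∣ n} μ(d) = [n = 1]` (Mathlib's `μ * ζ = 1`) at `n = gcd(m, b)`; valid for all `m, b` (at `gcd(0,0) = 0`
both sides vanish).  The divisor-sum identity is landed in several tree files with much heavier imports
(e.g. `MontgomeryVaughan1975.sum_divisors_moebius_eq`); it is re-derived inline (three lines) to keep this
file elementary. [folklore] -/
theorem ite_coprime_eq_sum_moebius (m b : ℕ) :
    (if Nat.Coprime m b then (1 : ℂ) else 0) = ∑ g ∈ (Nat.gcd m b).divisors, (μ g : ℂ) := by
  have h := congrArg (fun f : ArithmeticFunction ℂ => f (Nat.gcd m b))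
    (ArithmeticFunction.coe_moebius_mul_coe_zeta (R := ℂ))
  simp only [ArithmeticFunction.coe_mul_zeta_apply, ArithmeticFunction.intCoe_apply,
    ArithmeticFunction.one_apply] at h
  rw [h]

/-- For `1 ≤ m ≤ G`, the divisors of `gcd(m, b)` are exactly the `g ∈ [1, G]` with `g ∣ m` and `g ∣ b`.
[folklore] -/
theorem divisors_gcd_eq_filter {m G : ℕ} (hm : 1 ≤ m) (hmG : m ≤ G) (b : ℕ) :
    (Nat.gcd m b).divisors = (Finset.Icc 1 G).filter (fun g => g ∣ m ∧ g ∣ b) := by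
  ext g
  simp only [Nat.mem_divisors, Nat.dvd_gcd_iff, Finset.mem_filter, Finset.mem_Icc]
  constructor
  · rintro ⟨⟨hgm, hgb⟩, -⟩
    exact ⟨⟨Nat.pos_of_dvd_of_pos hgm hm, (Nat.le_of_dvd hm hgm).trans hmG⟩, hgm, hgb⟩
  · rintro ⟨-, hgm, hgb⟩
    exact ⟨⟨hgm, hgb⟩, Nat.gcd_ne_zero_left (by omega)⟩

/-! ### The exact expansion -/

/-- **Möbius expansion of a coprimality-restricted double sum.**  If every `m ∈ A` satisfies
`1 ≤ m ≤ G`, then for any finite `B ⊆ ℕ` and any weight `f`,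
`∑_{m ∈ A} ∑_{b ∈ B} 1_{gcd(m,b)=1} f(m,b) = ∑_{g=1}^{G} μ(g) ∑_{m ∈ A, g ∣ m} ∑_{b ∈ B, g ∣ b} f(m,b)`:
insert `1_{gcd=1} = ∑_{g ∣ gcd(m,b)} μ(g)`, note `g ∣ gcd(m,b) ⟺ g ∣ m ∧ g ∣ b` with `g ≤ m ≤ G`, and
interchange the summations. [folklore] -/
theorem sum_sum_ite_coprime_eq_sum_moebius (f : ℕ → ℕ → ℂ) {A : Finset ℕ} (B : Finset ℕ) {G : ℕ}
    (hA : ∀ m ∈ A, 1 ≤ m) (hAG : ∀ m ∈ A, m ≤ G) :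
    ∑ m ∈ A, ∑ b ∈ B, (if Nat.Coprime m b then f m b else 0) =
      ∑ g ∈ Finset.Icc 1 G, (μ g : ℂ) *
        ∑ m ∈ A.filter (fun m => g ∣ m), ∑ b ∈ B.filter (fun b => g ∣ b), f m b := by
  calc ∑ m ∈ A, ∑ b ∈ B, (if Nat.Coprime m b then f m b else 0)
      = ∑ m ∈ A, ∑ b ∈ B, ∑ g ∈ Finset.Icc 1 G,
          (if g ∣ m ∧ g ∣ b then (μ g : ℂ) * f m b else 0) := by
        refine Finset.sum_congr rfl fun m hm => Finset.sum_congr rfl fun b _ => ?_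
        rw [← Finset.sum_filter, ← divisors_gcd_eq_filter (hA m hm) (hAG m hm) b, ← Finset.sum_mul,
          ← ite_coprime_eq_sum_moebius, boole_mul]
    _ = ∑ m ∈ A, ∑ g ∈ Finset.Icc 1 G, ∑ b ∈ B,
          (if g ∣ m ∧ g ∣ b then (μ g : ℂ) * f m b else 0) :=
        Finset.sum_congr rfl fun _ _ => Finset.sum_comm
    _ = ∑ g ∈ Finset.Icc 1 G, ∑ m ∈ A, ∑ b ∈ B,
          (if g ∣ m ∧ g ∣ b then (μ g : ℂ) * f m b else 0) := Finset.sum_comm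
    _ = _ := by
        refine Finset.sum_congr rfl fun g _ => ?_
        rw [Finset.mul_sum, Finset.sum_filter]
        refine Finset.sum_congr rfl fun m _ => ?_
        by_cases hgm : g ∣ m
        · rw [if_pos hgm, Finset.mul_sum, Finset.sum_filter]
          exact Finset.sum_congr rfl fun b _ => by simp only [hgm, true_and]
        · rw [if_neg hgm]
          exact Finset.sum_eq_zero fun b _ => if_neg fun h => hgm h.1

/-- The same expansion with the range of `g` controlled by `B ⊆ [1, G]` instead of `A`
(`gcd(m, b) ≤ b`). [folklore] -/
theorem sum_sum_ite_coprime_eq_sum_moebius' (f : ℕ → ℕ → ℂ) (A : Finset ℕ) {B : Finset ℕ} {G : ℕ}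
    (hB : ∀ b ∈ B, 1 ≤ b) (hBG : ∀ b ∈ B, b ≤ G) :
    ∑ m ∈ A, ∑ b ∈ B, (if Nat.Coprime m b then f m b else 0) =
      ∑ g ∈ Finset.Icc 1 G, (μ g : ℂ) *
        ∑ m ∈ A.filter (fun m => g ∣ m), ∑ b ∈ B.filter (fun b => g ∣ b), f m b := by
  calc ∑ m ∈ A, ∑ b ∈ B, (if Nat.Coprime m b then f m b else 0)
      = ∑ b ∈ B, ∑ m ∈ A, (if Nat.Coprime b m then Function.swap f b m else 0) := by
        rw [Finset.sum_comm]
        exact Finset.sum_congr rfl fun b _ => Finset.sum_congr rfl fun m _ =>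
          if_congr Nat.coprime_comm rfl rfl
    _ = _ := by
        rw [sum_sum_ite_coprime_eq_sum_moebius (Function.swap f) A hB hBG]
        exact Finset.sum_congr rfl fun g _ => by rw [Finset.sum_comm]

/-! ### Truncation of the `g`-range -/

/-- Splitting `∑_{g=1}^{G} − ∑_{g=1}^{G₀} = ∑_{G₀ < g ≤ G}` for `G₀ ≤ G` (`[1, n] = (0, n]`). [folklore] -/
theorem sum_Icc_one_sub_sum_Icc_one {M : Type*} [AddCommGroup M] (F : ℕ → M) {G₀ G : ℕ}
    (h : G₀ ≤ G) :
    ∑ g ∈ Finset.Icc 1 G, F g - ∑ g ∈ Finset.Icc 1 G₀, F g = ∑ g ∈ Finset.Ioc G₀ G, F g := by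
  have hI : ∀ n : ℕ, Finset.Icc 1 n = Finset.Ioc 0 n := fun n => by
    ext g
    simp only [Finset.mem_Icc, Finset.mem_Ioc, Nat.succ_le_iff]
  rw [hI, hI, ← Finset.sum_Ioc_consecutive F (Nat.zero_le G₀) h, add_sub_cancel_left]

/-- **Truncated Möbius expansion.**  With `S_g := ∑_{m ∈ A, g∣m} ∑_{b ∈ B, g∣b} f(m,b)` and `A ⊆ [1, G]`,
for every `G₀ ≤ G`:
`‖∑_{m,b} 1_{gcd(m,b)=1} f(m,b) − ∑_{g=1}^{G₀} μ(g) S_g‖ ≤ ∑_{G₀ < g ≤ G} ‖S_g‖` (`|μ| ≤ 1`). [folklore] -/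
theorem norm_sub_sum_Icc_le (f : ℕ → ℕ → ℂ) {A : Finset ℕ} (B : Finset ℕ) {G₀ G : ℕ}
    (hA : ∀ m ∈ A, 1 ≤ m) (hAG : ∀ m ∈ A, m ≤ G) (hG₀ : G₀ ≤ G) :
    ‖∑ m ∈ A, ∑ b ∈ B, (if Nat.Coprime m b then f m b else 0) -
        ∑ g ∈ Finset.Icc 1 G₀, (μ g : ℂ) *
          ∑ m ∈ A.filter (fun m => g ∣ m), ∑ b ∈ B.filter (fun b => g ∣ b), f m b‖ ≤
      ∑ g ∈ Finset.Ioc G₀ G,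
        ‖∑ m ∈ A.filter (fun m => g ∣ m), ∑ b ∈ B.filter (fun b => g ∣ b), f m b‖ := by
  rw [sum_sum_ite_coprime_eq_sum_moebius f B hA hAG, sum_Icc_one_sub_sum_Icc_one _ hG₀]
  refine (norm_sum_le _ _).trans (Finset.sum_le_sum fun g _ => ?_)
  rw [norm_mul, Complex.norm_intCast]
  exact mul_le_of_le_one_left (norm_nonneg _) (by exact_mod_cast ArithmeticFunction.abs_moebius_le_one)

/-- The tail bounded termwise: the truncation error is at most
`∑_{G₀ < g ≤ G} ∑_{m ∈ A, g∣m} ∑_{b ∈ B, g∣b} ‖f(m,b)‖`. [folklore] -/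
theorem norm_sub_sum_Icc_le_sum_norm (f : ℕ → ℕ → ℂ) {A : Finset ℕ} (B : Finset ℕ) {G₀ G : ℕ}
    (hA : ∀ m ∈ A, 1 ≤ m) (hAG : ∀ m ∈ A, m ≤ G) (hG₀ : G₀ ≤ G) :
    ‖∑ m ∈ A, ∑ b ∈ B, (if Nat.Coprime m b then f m b else 0) -
        ∑ g ∈ Finset.Icc 1 G₀, (μ g : ℂ) *
          ∑ m ∈ A.filter (fun m => g ∣ m), ∑ b ∈ B.filter (fun b => g ∣ b), f m b‖ ≤
      ∑ g ∈ Finset.Ioc G₀ G,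
        ∑ m ∈ A.filter (fun m => g ∣ m), ∑ b ∈ B.filter (fun b => g ∣ b), ‖f m b‖ :=
  (norm_sub_sum_Icc_le f B hA hAG hG₀).trans (Finset.sum_le_sum fun _ _ =>
    (norm_sum_le _ _).trans (Finset.sum_le_sum fun _ _ => norm_sum_le _ _))

/-- Real nonnegative weights: if every `f(m,b)` (`m ∈ A`, `b ∈ B`) is a nonnegative real, then
`‖f(m,b)‖ = Re f(m,b)` and the truncation error is at most `∑_{G₀ < g ≤ G} Re S_g`. [folklore] -/
theorem norm_sub_sum_Icc_le_sum_re (f : ℕ → ℕ → ℂ) {A : Finset ℕ} (B : Finset ℕ) {G₀ G : ℕ}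
    (hA : ∀ m ∈ A, 1 ≤ m) (hAG : ∀ m ∈ A, m ≤ G) (hG₀ : G₀ ≤ G)
    (hf : ∀ m ∈ A, ∀ b ∈ B, 0 ≤ (f m b).re ∧ (f m b).im = 0) :
    ‖∑ m ∈ A, ∑ b ∈ B, (if Nat.Coprime m b then f m b else 0) -
        ∑ g ∈ Finset.Icc 1 G₀, (μ g : ℂ) *
          ∑ m ∈ A.filter (fun m => g ∣ m), ∑ b ∈ B.filter (fun b => g ∣ b), f m b‖ ≤
      ∑ g ∈ Finset.Ioc G₀ G,
        (∑ m ∈ A.filter (fun m => g ∣ m), ∑ b ∈ B.filter (fun b => g ∣ b), f m b).re := by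
  refine (norm_sub_sum_Icc_le_sum_norm f B hA hAG hG₀).trans (le_of_eq (Finset.sum_congr rfl fun g _ => ?_))
  rw [Complex.re_sum]
  refine Finset.sum_congr rfl fun m hm => ?_
  rw [Complex.re_sum]
  refine Finset.sum_congr rfl fun b hb => ?_
  obtain ⟨hre, him⟩ := hf m (Finset.mem_filter.1 hm).1 b (Finset.mem_filter.1 hb).1
  have hz : f m b = ((f m b).re : ℂ) := Complex.ext (by simp) (by simp [him])
  rw [hz, Complex.norm_real, Real.norm_of_nonneg hre, Complex.ofReal_re]

/-! ### The crude tail: `‖f‖ ≤ C`, `A ⊆ [1, N]`, `B ⊆ [1, N']` -/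

/-- `#{m ∈ A : g ∣ m} ≤ N / g` for `A ⊆ [1, N]`. [folklore] -/
theorem card_filter_dvd_le_div {A : Finset ℕ} {N : ℕ} (hA : ∀ m ∈ A, 1 ≤ m) (hAN : ∀ m ∈ A, m ≤ N)
    (g : ℕ) : #(A.filter (fun m => g ∣ m)) ≤ N / g := by
  rw [← Nat.Ioc_filter_dvd_card_eq_div N g]
  exact Finset.card_le_card (Finset.filter_subset_filter _ fun m hm =>
    Finset.mem_Ioc.2 ⟨hA m hm, hAN m hm⟩)

/-- `∑_{G₀ < g ≤ G} 1/g² ≤ 1/G₀ − 1/G` for `1 ≤ G₀ ≤ G` (telescoping, `1/g² ≤ 1/(g−1) − 1/g`). [folklore] -/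
theorem sum_Ioc_inv_sq_le {G₀ G : ℕ} (hG₀ : 1 ≤ G₀) (h : G₀ ≤ G) :
    ∑ g ∈ Finset.Ioc G₀ G, ((g : ℝ) ^ 2)⁻¹ ≤ (G₀ : ℝ)⁻¹ - (G : ℝ)⁻¹ := by
  induction G, h using Nat.le_induction with
  | base => simp
  | succ G hG ih =>
    rw [Finset.sum_Ioc_succ_top hG]
    have hG1 : (1 : ℝ) ≤ G := by exact_mod_cast hG₀.trans hG
    have key : (((G + 1 : ℕ) : ℝ) ^ 2)⁻¹ ≤ (G : ℝ)⁻¹ - ((G + 1 : ℕ) : ℝ)⁻¹ := by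
      rw [Nat.cast_succ, inv_sub_inv (by positivity) (by positivity), add_sub_cancel_left, one_div,
        sq]
      exact inv_anti₀ (by positivity) (by nlinarith)
    linarith

/-- `∑_{G₀ < g ≤ G} ⌊N/g⌋ ⌊N'/g⌋ ≤ N N' / G₀` for `1 ≤ G₀`. [folklore] -/
theorem sum_Ioc_div_mul_div_le (N N' : ℕ) {G₀ : ℕ} (hG₀ : 1 ≤ G₀) (G : ℕ) :
    ∑ g ∈ Finset.Ioc G₀ G, ((N / g : ℕ) : ℝ) * ((N' / g : ℕ) : ℝ) ≤ (N : ℝ) * N' / G₀ := by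
  rcases le_or_gt G₀ G with h | h
  · calc ∑ g ∈ Finset.Ioc G₀ G, ((N / g : ℕ) : ℝ) * ((N' / g : ℕ) : ℝ)
        ≤ ∑ g ∈ Finset.Ioc G₀ G, (N : ℝ) * N' * ((g : ℝ) ^ 2)⁻¹ := by
          refine Finset.sum_le_sum fun g hg => ?_
          have hg0 : (0 : ℝ) < g := by exact_mod_cast Nat.zero_lt_of_lt (Finset.mem_Ioc.1 hg).1
          rw [sq, mul_inv, mul_mul_mul_comm]
          exact mul_le_mul (by rw [← div_eq_mul_inv]; exact Nat.cast_div_le)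
            (by rw [← div_eq_mul_inv]; exact Nat.cast_div_le) (Nat.cast_nonneg _)
            (mul_nonneg (Nat.cast_nonneg _) (inv_nonneg.2 hg0.le))
      _ ≤ (N : ℝ) * N' * ((G₀ : ℝ)⁻¹ - (G : ℝ)⁻¹) := by
          rw [← Finset.mul_sum]
          exact mul_le_mul_of_nonneg_left (sum_Ioc_inv_sq_le hG₀ h) (by positivity)
      _ ≤ (N : ℝ) * N' / G₀ := by
          rw [div_eq_mul_inv]
          exact mul_le_mul_of_nonneg_left (sub_le_self _ (inv_nonneg.2 (Nat.cast_nonneg _)))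
            (by positivity)
  · rw [Finset.Ioc_eq_empty_of_le h.le, Finset.sum_empty]
    positivity

/-- **Crude tail bound.**  If `‖f(m,b)‖ ≤ C` on `A × B` (`0 ≤ C`), `A ⊆ [1, N] ∩ [1, G]`, `B ⊆ [1, N']` and
`1 ≤ G₀ ≤ G`, the Möbius expansion truncated at `G₀` is off by at most `C N N' / G₀`
(`#{m ∈ A : g∣m} #{b ∈ B : g∣b} ≤ ⌊N/g⌋ ⌊N'/g⌋` and `∑_{g > G₀} 1/g² ≤ 1/G₀`). [folklore] -/
theorem norm_sub_sum_Icc_le_crude (f : ℕ → ℕ → ℂ) {A B : Finset ℕ} {N N' G₀ G : ℕ} {C : ℝ}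
    (hC : 0 ≤ C) (hf : ∀ m ∈ A, ∀ b ∈ B, ‖f m b‖ ≤ C)
    (hA : ∀ m ∈ A, 1 ≤ m) (hAN : ∀ m ∈ A, m ≤ N) (hAG : ∀ m ∈ A, m ≤ G)
    (hB : ∀ b ∈ B, 1 ≤ b) (hBN : ∀ b ∈ B, b ≤ N') (hG₀ : 1 ≤ G₀) (hG : G₀ ≤ G) :
    ‖∑ m ∈ A, ∑ b ∈ B, (if Nat.Coprime m b then f m b else 0) -
        ∑ g ∈ Finset.Icc 1 G₀, (μ g : ℂ) *
          ∑ m ∈ A.filter (fun m => g ∣ m), ∑ b ∈ B.filter (fun b => g ∣ b), f m b‖ ≤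
      C * (N * N' / G₀) := by
  refine (norm_sub_sum_Icc_le_sum_norm f B hA hAG hG).trans ?_
  calc ∑ g ∈ Finset.Ioc G₀ G,
        ∑ m ∈ A.filter (fun m => g ∣ m), ∑ b ∈ B.filter (fun b => g ∣ b), ‖f m b‖
      ≤ ∑ g ∈ Finset.Ioc G₀ G, C * (((N / g : ℕ) : ℝ) * ((N' / g : ℕ) : ℝ)) := by
        refine Finset.sum_le_sum fun g _ => ?_
        calc ∑ m ∈ A.filter (fun m => g ∣ m), ∑ b ∈ B.filter (fun b => g ∣ b), ‖f m b‖
            ≤ ∑ m ∈ A.filter (fun m => g ∣ m), ∑ b ∈ B.filter (fun b => g ∣ b), C :=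
              Finset.sum_le_sum fun m hm => Finset.sum_le_sum fun b hb =>
                hf m (Finset.mem_filter.1 hm).1 b (Finset.mem_filter.1 hb).1
          _ = #(A.filter (fun m => g ∣ m)) * (#(B.filter (fun b => g ∣ b)) * C) := by
              simp only [Finset.sum_const, nsmul_eq_mul]
          _ ≤ (N / g : ℕ) * ((N' / g : ℕ) * C) :=
              mul_le_mul (by exact_mod_cast card_filter_dvd_le_div hA hAN g)
                (mul_le_mul_of_nonneg_right (by exact_mod_cast card_filter_dvd_le_div hB hBN g) hC)
                (mul_nonneg (Nat.cast_nonneg _) hC) (Nat.cast_nonneg _)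
          _ = C * (((N / g : ℕ) : ℝ) * ((N' / g : ℕ) : ℝ)) := by ring
    _ ≤ C * (N * N' / G₀) := by
        rw [← Finset.mul_sum]
        exact mul_le_mul_of_nonneg_left (sum_Ioc_div_mul_div_le N N' hG₀ G) hC

/-! ### Re-indexing the sublattice of multiples of `g` -/

/-- Re-indexing a sum over the multiples of `g` in `A` by `m = g m'`, `m' = m / g`
(for `g = 0` both sides are the value at `0 ∈ A`, if any). [folklore] -/
theorem sum_filter_dvd_eq_sum_image_div {M : Type*} [AddCommMonoid M] (g : ℕ) (A : Finset ℕ)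
    (F : ℕ → M) :
    ∑ m ∈ A.filter (fun m => g ∣ m), F m =
      ∑ m' ∈ (A.filter (fun m => g ∣ m)).image (fun m => m / g), F (g * m') := by
  rw [Finset.sum_image]
  · exact Finset.sum_congr rfl fun m hm => by rw [Nat.mul_div_cancel' (Finset.mem_filter.1 hm).2]
  · intro m hm m' hm' h
    rw [← Nat.mul_div_cancel' (Finset.mem_filter.1 hm).2, ← Nat.mul_div_cancel' (Finset.mem_filter.1 hm').2]
    exact congrArg (g * ·) h

/-- If `g` is not `k`-smooth, no `k`-smooth number is a multiple of `g`: the sublattice of multiples of `g`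
in a set of `k`-smooth numbers is empty. [folklore] -/
theorem filter_dvd_eq_empty_of_not_mem_smoothNumbers {g k : ℕ} (hg : g ∉ Nat.smoothNumbers k)
    {A : Finset ℕ} (hA : ∀ m ∈ A, m ∈ Nat.smoothNumbers k) : A.filter (fun m => g ∣ m) = ∅ :=
  Finset.filter_eq_empty_iff.2 fun m hm hgm => hg (Nat.mem_smoothNumbers_of_dvd (hA m hm) hgm)

/-- The multiples of a `k`-smooth `g` among the `k`-smooth `n ≤ N` are exactly the `g n'` with `n'`
`k`-smooth and `n' ≤ N / g`. [folklore] -/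
theorem filter_dvd_smoothNumbersUpTo {g k : ℕ} (hg : g ∈ Nat.smoothNumbers k) (N : ℕ) :
    (Nat.smoothNumbersUpTo N k).filter (fun n => g ∣ n) =
      (Nat.smoothNumbersUpTo (N / g) k).image (fun n => g * n) := by
  have hg0 : 0 < g := Nat.pos_of_ne_zero (Nat.ne_zero_of_mem_smoothNumbers hg)
  ext n
  simp only [Finset.mem_filter, Finset.mem_image, Nat.mem_smoothNumbersUpTo,
    Nat.le_div_iff_mul_le hg0]
  constructor
  · rintro ⟨⟨hn, hns⟩, n', rfl⟩
    exact ⟨n', ⟨by rwa [mul_comm] at hn, Nat.mem_smoothNumbers_of_dvd hns (dvd_mul_left n' g)⟩, rfl⟩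
  · rintro ⟨n', ⟨hn', hn's⟩, rfl⟩
    exact ⟨⟨by rwa [mul_comm] at hn', Nat.mul_mem_smoothNumbers hg hn's⟩, dvd_mul_right g n'⟩

/-- **The sublattice of a friable box.**  For `g` `k`-smooth, the multiples of `g` in the box
`S(N, k) \ S(N', k)` of `k`-smooth `n` with `N' < n ≤ N` are exactly the `g n'`, `n' ∈ S(N/g, k) \ S(N'/g, k)`
(`g n' ≤ N ⟺ n' ≤ ⌊N/g⌋`; `g n'` is `k`-smooth iff `n'` is). [folklore] -/
theorem filter_dvd_smoothNumbersUpTo_sdiff {g k : ℕ} (hg : g ∈ Nat.smoothNumbers k) (N N' : ℕ) :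
    (Nat.smoothNumbersUpTo N k \ Nat.smoothNumbersUpTo N' k).filter (fun n => g ∣ n) =
      (Nat.smoothNumbersUpTo (N / g) k \ Nat.smoothNumbersUpTo (N' / g) k).image (fun n => g * n) := by
  have hg0 : 0 < g := Nat.pos_of_ne_zero (Nat.ne_zero_of_mem_smoothNumbers hg)
  have hN := Finset.ext_iff.1 (filter_dvd_smoothNumbersUpTo hg N)
  have hN' := Finset.ext_iff.1 (filter_dvd_smoothNumbersUpTo hg N')
  simp only [Finset.mem_filter, Finset.mem_image] at hN hN'
  ext n
  simp only [Finset.mem_filter, Finset.mem_sdiff, Finset.mem_image]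
  constructor
  · rintro ⟨⟨hn, hnN'⟩, hgn⟩
    obtain ⟨n', hn', rfl⟩ := (hN n).1 ⟨hn, hgn⟩
    exact ⟨n', ⟨hn', fun h => hnN' ((hN' _).2 ⟨n', h, rfl⟩).1⟩, rfl⟩
  · rintro ⟨n', ⟨hn', hn'N'⟩, rfl⟩
    obtain ⟨hn, hgn⟩ := (hN _).2 ⟨n', hn', rfl⟩
    refine ⟨⟨hn, fun h => hn'N' ?_⟩, hgn⟩
    obtain ⟨n'', hn'', he⟩ := (hN' _).1 ⟨h, hgn⟩
    rwa [← Nat.eq_of_mul_eq_mul_left hg0 he]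

/-- The sum form of the friable re-indexing: for `g` `k`-smooth,
`∑_{m ∈ S(N,k) \ S(N',k), g ∣ m} F(m) = ∑_{m' ∈ S(N/g,k) \ S(N'/g,k)} F(g m')`. [folklore] -/
theorem sum_filter_dvd_smoothNumbersUpTo_sdiff {M : Type*} [AddCommMonoid M] {g k : ℕ}
    (hg : g ∈ Nat.smoothNumbers k) (N N' : ℕ) (F : ℕ → M) :
    ∑ m ∈ (Nat.smoothNumbersUpTo N k \ Nat.smoothNumbersUpTo N' k).filter (fun n => g ∣ n), F m =
      ∑ m' ∈ Nat.smoothNumbersUpTo (N / g) k \ Nat.smoothNumbersUpTo (N' / g) k, F (g * m') := by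
  have hg0 : 0 < g := Nat.pos_of_ne_zero (Nat.ne_zero_of_mem_smoothNumbers hg)
  rw [filter_dvd_smoothNumbersUpTo_sdiff hg, Finset.sum_image fun a _ b _ h =>
    Nat.eq_of_mul_eq_mul_left hg0 h]

/-- The same for a full box: `∑_{m ∈ S(N,k), g ∣ m} F(m) = ∑_{m' ∈ S(N/g,k)} F(g m')`. [folklore] -/
theorem sum_filter_dvd_smoothNumbersUpTo {M : Type*} [AddCommMonoid M] {g k : ℕ}
    (hg : g ∈ Nat.smoothNumbers k) (N : ℕ) (F : ℕ → M) :
    ∑ m ∈ (Nat.smoothNumbersUpTo N k).filter (fun n => g ∣ n), F m =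
      ∑ m' ∈ Nat.smoothNumbersUpTo (N / g) k, F (g * m') := by
  have hg0 : 0 < g := Nat.pos_of_ne_zero (Nat.ne_zero_of_mem_smoothNumbers hg)
  rw [filter_dvd_smoothNumbersUpTo hg, Finset.sum_image fun a _ b _ h => Nat.eq_of_mul_eq_mul_left hg0 h]

/-- The image form: dividing the multiples of a `k`-smooth `g` in `S(N,k) \ S(N',k)` by `g` gives exactly
`S(N/g, k) \ S(N'/g, k)`. [folklore] -/
theorem image_div_filter_dvd_smoothNumbersUpTo_sdiff {g k : ℕ} (hg : g ∈ Nat.smoothNumbers k)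
    (N N' : ℕ) :
    ((Nat.smoothNumbersUpTo N k \ Nat.smoothNumbersUpTo N' k).filter (fun n => g ∣ n)).image
        (fun m => m / g) =
      Nat.smoothNumbersUpTo (N / g) k \ Nat.smoothNumbersUpTo (N' / g) k := by
  have hg0 : 0 < g := Nat.pos_of_ne_zero (Nat.ne_zero_of_mem_smoothNumbers hg)
  rw [filter_dvd_smoothNumbersUpTo_sdiff hg, Finset.image_image]
  exact (Finset.image_congr fun n _ => Nat.mul_div_cancel_left n hg0).trans Finset.image_id'

/-! ### Transport of residue classes along `m = g m'` -/

/-- For `g` invertible modulo `M₀` with inverse `u` (`g u ≡ 1`): `g m' ≡ c ⟺ m' ≡ c u (mod M₀)`.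
[folklore] -/
theorem mul_modEq_iff {g u M₀ : ℕ} (hu : g * u ≡ 1 [MOD M₀]) (m' c : ℕ) :
    g * m' ≡ c [MOD M₀] ↔ m' ≡ c * u [MOD M₀] := by
  constructor
  · intro h
    calc m' = m' * 1 := (mul_one _).symm
      _ ≡ m' * (g * u) [MOD M₀] := (hu.mul_left m').symm
      _ = g * m' * u := by ring
      _ ≡ c * u [MOD M₀] := h.mul_right u
  · intro h
    calc g * m' ≡ g * (c * u) [MOD M₀] := h.mul_left g
      _ = c * (g * u) := by ring
      _ ≡ c * 1 [MOD M₀] := hu.mul_left c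
      _ = c := mul_one c

/-- The class of a multiple `m` of `g` determines the class of `m / g` and conversely, for `g` invertible
modulo `M₀` with inverse `u`: `m ≡ c ⟺ m / g ≡ c u (mod M₀)`. [folklore] -/
theorem modEq_iff_div_modEq {g u M₀ : ℕ} (hu : g * u ≡ 1 [MOD M₀]) {m : ℕ} (hgm : g ∣ m) (c : ℕ) :
    m ≡ c [MOD M₀] ↔ m / g ≡ c * u [MOD M₀] := by
  conv_lhs => rw [← Nat.mul_div_cancel' hgm]
  exact mul_modEq_iff hu (m / g) c

/-- A `g` coprime to `M₀ ≠ 0` has an inverse `u` modulo `M₀`. [folklore] -/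
theorem exists_mul_modEq_one {g M₀ : ℕ} (h : Nat.Coprime g M₀) (hM : M₀ ≠ 0) :
    ∃ u, g * u ≡ 1 [MOD M₀] := by
  obtain ⟨u, -, hu⟩ := Nat.exists_mul_mod_eq_of_coprime 1 h hM
  exact ⟨u, hu⟩

end CoprimeMoebiusExpansion

end Literature.NumberTheory.Sieve
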